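import Summits.BirchSwinnertonDyer.BirchSwinnertonDyer.Theses.SelmerRank
import Summits.BirchSwinnertonDyer.BirchSwinnertonDyer.Theorems.SelmerRankSelmerRankLBStubDeltaOne
import Summits.BirchSwinnertonDyer.BirchSwinnertonDyer.Theorems.SelmerRankSelmerRankLBStubDeltaParity
import Summits.BirchSwinnertonDyer.BirchSwinnertonDyer.Theorems.SelmerRankSelmerRankLBStubKimOrder
import Summits.BirchSwinnertonDyer.BirchSwinnertonDyer.Theorems.SelmerRankSelmerRankLBStubDeltaPrime
import Literature.NumberTheory.EllipticCurves.KuriharaNumber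
import Literature.NumberTheory.EllipticCurves.KatoKolyvaginPrimes
import Literature.NumberTheory.EllipticCurves.CuspFormLFunction

/-!
# Line `kurihara-order` for crux `SelmerRankLB` (stmt-BirchSwinnertonDyer-0131)

STATUS (lead `prover-line-stmt-BirchSwinnertonDyer-0131-0`, cycle 1, 2026-08-17): sorries 3 = stubs
K, V2a (both CLOSED MODULO named Literature facts by landed `_of_facts` theorems, see the stub
bodies) and V2b (OPEN core). V0 `stub_delta_one` and V1 `stub_delta_parity` are LANDED unconditional
theorems (`Theorems/SelmerRankSelmerRankLBStubDeltaOne.lean`, `…StubDeltaParity{,Lemmas,NormRelation}.lean`).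
Hence, kernel-checked modulo {modularity `exists_isNewformOf`, Kim 2022 Thm 1.9 (1) in both
directions (`Kim2022_exists_kuriharaNumber_ne_zero_of_selmerCorank`,
`Kim2022_selmerCorank_le_of_kuriharaNumber_ne_zero`), the period unit
`realPeriodRat_eq_unit_mul_plusPeriod`, `p`-parity `selmerCorank_mod_two_eq`, the corank-1
`p`-converse `yanZhu_analyticRank_eq_one_of_selmerCorank_eq_one`}: crux ⟸ V2b; and conversely
V2b ⟸ crux (Disproof.lean `stubKV_of_summit_of_kim` pattern with the crux in place of the summit).

Skeleton registered by the crux-strategist seat `cstrat-stmt-BirchSwinnertonDyer-0131-b1`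
(2026-08-17, BEFORE any lead: judge attack axis 2.0). Card: `Lines/kurihara-order.md`; census:
`STRATEGY-CENSUS.md` (same crux directory). Slug `kurihara-order`.

IMPORT NOTE. The item is shared by six routes whose `def SelmerRankLB` bodies are `rfl`-equal
(`CruxAttackProbes.lean`); this file imports only `Theses.SelmerRank` (the item's original route,
decl `Summit.BirchSwinnertonDyer.BirchSwinnertonDyer.Theses.SelmerRank.SelmerRankLB`) and concludes
THAT decl by name; `TangentCone.SelmerRankLB` (payload route) is the same term — the folder copy
`line-kurihara-order.both.lean` (imports both theses, lean check rc 0) derives it by `SelmerRankLB_of`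
verbatim. The single import keeps the skeleton elaborating while `Theses.TangentCone` is being
rewritten by the gate (farm coherence).

## The crux (recall; shared verbatim by the six routes SelmerRank / ShadowIsolation / ToricShedding /
FrozenTwin / TangentCone / VerticalContact — the six `def SelmerRankLB` bodies are `rfl`-equal)

`∀ W p, 5 ≤ p → good at p → p ∤ a_p → ρ̄_{E,p} onto → W.analyticRank ≤ W.selmerCorank p`:
the LOWER-BOUND half of `p^∞`-Selmer BSD at a big-image good ordinary prime. Theorem for
`r_an ≤ 3` (corank-0 / corank-1 `p`-converses + `p`-parity), OPEN from `r_an = 4`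
(`CruxAttack-r1.md` §8: first open instance = the rank-2 `p`-converse).

## The line: transfer to the ORDER OF VANISHING OF THE KURIHARA NUMBERS

Lever (C.-H. Kim, *The structure of Selmer groups and the Iwasawa main conjecture for elliptic
curves*, Amer. J. Math. = arXiv:2203.12159, Thm. 1.9 (1) with Cor. 1.6): for `E/ℚ`, `p ≥ 5`,
`ρ̄` surjective, Manin constant prime to `p` (automatic at a good `p ≥ 5`), and `E` good ORDINARY at
`p` (so that the main conjecture localised at `XΛ` is a theorem: Kato 2004 Thm. 17.4 +
Skinner–Urban 2014 / Burungale–Castella–Skinner 2025 Thm. 1.1.2, audited in the tree docstring of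
`Literature.NumberTheory.EllipticCurves.Kim2022_kuriharaNumber_certificate`),

  `corank_{ℤ_p} Sel(ℚ, E[p^∞]) = ord(δ̃) := min {ν(n) : n ∈ 𝒩₁, δ̃_n ≠ 0 in ℤ_p/I_n ℤ_p}`,

where `δ̃_n = Σ_{a ∈ (ℤ/n)ˣ} [a/n]⁺ · Π_{ℓ ∣ n} log_{η_ℓ}(a)` is the Kurihara number (tree:
`kuriharaNumber f (p^k) n ψ`, file `KuriharaNumber`), `n` runs over square-free products of
Kolyvagin primes (tree: `Kato.IsKolyvaginProduct W p k n`, file `KatoKolyvaginPrimes`), and NO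
`p`-adic height, NO semisimplicity of `X(E/ℚ_∞)`, NO finiteness of `Ш` enters (contrast: the
cyclotomic-order decomposition `r_an ≤ ord_T L_p = ord_T char X ≥ corank` needs Greenberg's
semisimplicity Conj. 1.12 — route item `PAdicOrderSemisimpleR3` — for its last inequality, open
already in rank one; census §Decomposition).

Hence, at the primes of the crux, `SelmerRankLB ⟺ r_an ≤ ord(δ̃) ⟺` **the Kurihara numbers vanish
below the analytic rank**:

  `(KV)  ∀ n ∈ 𝒩_k, ν(n) < ord_{s=1} L(E,s) ⇒ δ̃_n^{(k)} = 0 in ℤ/p^k`,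

a statement in which no Selmer group, no Galois cohomology and no Iwasawa module appears: it compares
the Taylor expansion of `L(E,s)` at `s = 1` (archimedean) with congruences modulo `p^k` among the
algebraic parts of the twisted central values `L(E,χ,1)`, `cond χ ∣ n`, `χ` of `p`-power order
(Kurihara numbers are the top mixed Taylor coefficients of the Mazur–Tate elements
`θ_{ℚ(μ_n)} = Σ_a [a/n]⁺ σ_a`, Kim §3.5; `(KV)` is implied by the analytic-rank form of the
Mazur–Tate "weak vanishing" conjecture `θ_{ℚ(μ_n)} ∈ I^{r_an}`, Mazur–Tate 1987 Conj. 1).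

`(KV)` splits by LEVEL and PARITY into four stubs of very different status:
* `n = 1`: `δ̃_1 = [0]⁺ = L(E,1)/Ω⁺` vanishes iff `r_an ≥ 1` (stub V0, known: modularity + Hecke);
* `(−1)^{ν(n)} ≠ w(E) = (−1)^{r_an}`: `δ̃_n = 0` by the Mazur–Tate functional equation
  (Kim Prop. 3.16 after Kurihara 2012; stub V1, known in print);
* `ν(n) = 1`, `r_an` odd `≥ 3`: `δ̃_ℓ = 0` for every Kolyvagin prime — TRUE, but its only proof runs
  through Selmer groups: `δ̃_ℓ ≠ 0 ⇒ cork ≤ 1` (Kim Thm. 1.9) `⇒ cork = 1` (Kim Cor. 1.12, `L(E,1) = 0`)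
  `⇒ r_an = 1` (corank-1 `p`-converse, Burungale–Castella–Grossi–Skinner 2026 Cor. 1 / Yan–Zhu Cor. 1.4
  / BSTW 2024 Thm. 1.10) — stub V2a, known in print (XL), the line's record that the odd layer `ν = 1`
  is exactly the corank-1 `p`-converse;
* `2 ≤ ν(n) < r_an`, `ν(n) ≡ r_an (mod 2)`: stub V2b, the OPEN CORE ("even gap"). Its first instance is
  `(r_an, ν(n)) = (4, 2)`: "for an analytic-rank-4 curve every `δ̃_{ℓℓ'}` vanishes mod `p^k`" — the
  rank-2 `p`-converse in modular-symbol clothing, stripped of all algebra; then `(5,3)`, `(6,2)`, ….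

        SelmerRankLB  ⇐  stub_kim_order_le_corank (K: ∃ n ∈ 𝒩_k, ν(n) ≤ corank_p, δ̃_n^{(k)} ≠ 0)
                         + (KV) = stub_delta_one (V0) ∧ stub_delta_parity (V1)
                                  ∧ stub_delta_prime_of_odd_rank (V2a) ∧ stub_delta_evenGap (V2b)
        proof: if corank < r_an then the witness n of K has ν(n) < r_an, so δ̃_n^{(k)} = 0 by
        V0 (n = 1) / V1 (wrong parity) / V2a (ν = 1, r_an odd ≥ 3) / V2b (ν ≥ 2). ∎

Stub K is the NON-VANISHING direction of Kim's theorem (`ord(δ̃) ≤ corank`, realised at some level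
`k` — robust under the period change `Ω⁺_E = u·Ω⁺_f`, `u ∈ ℚˣ`, by taking `k` large, Kim Lemma 3.14),
with the newform supplied by modularity (`exists_isNewformOf`, BCDT) at level `N_E` (Carayol); it is
a theorem in print (XL to formalise: Mazur–Rubin + Büyükboduk's `Λ`-adic rigidity + Kato's explicit
reciprocity law in Kolyvagin-derived form, Kim Thm. 3.13, + the main conjecture).

Disproof.lean: none exists for this crux yet (no cdisprove seat before this line; `CruxAttack-r1.md`
records `S → C` hypothesis-free, so the crux cannot be misstated-false). Barriers: see the card.
Typing checklist 4c: no determinantal representation, no Bochner integral (the modular symbols enter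
through the tree's `ratPlusSymbol : ℚ`), no complex-action partition function, no hand-picked
threshold; the discrete logarithms `ψ_ℓ` are universally quantified with surjectivity (vanishing is
independent of the choice: `kuriharaNumber_eq_zero_iff_of_surjective`), the level `k ≥ 1` is explicit,
`n = 0` is excluded by `IsKolyvaginProduct` (square-free) and `NeZero n`.
-/

noncomputable section

set_option linter.dupNamespace false

open scoped MatrixGroups ModularForm Classical

open CongruenceSubgroup Literature.NumberTheory.EllipticCurves
  Literature.NumberTheory.EllipticCurves.ModularForms

namespace Summit.BirchSwinnertonDyer.BirchSwinnertonDyer.Cruxes.SelmerRankLB.KuriharaOrder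

open Summit.BirchSwinnertonDyer.BirchSwinnertonDyer.Theses

/-! ### Stub K — Kim's theorem, non-vanishing direction (known in print, XL) -/

/-- **Stub K (`stub_kim_order_le_corank`) — the Kurihara numbers do not vanish identically, and the
first non-vanishing level is at most the Selmer corank.** For `E/ℚ` with globally minimal `W`,
`p ≥ 5` good ordinary with `ρ̄_{E,p}` surjective: the conductor `N_E` is positive, `E` has a newform
`f ∈ S₂(Γ₀(N_E))` (modularity, BCDT 2001 + Carayol), and there are a level `k ≥ 1`, a square-free
product `n ∈ 𝒩_k` of Kolyvagin primes (`ℓ ∤ N_E p`, `ℓ ≡ 1`, `a_ℓ ≡ ℓ + 1 (mod p^k)`) with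
`ν(n) ≤ corank_{ℤ_p} Sel_{p^∞}(E/ℚ)`, and surjective discrete logarithms `ψ_ℓ : (ℤ/ℓ)ˣ → ℤ/p^k`
(`ℓ ∣ n`) with `δ_n^{(k)} = kuriharaNumber f (p^k) n ψ ≠ 0`.
In print: Kim 2022 Thm. 1.9 (1) `cork Sel(ℚ,E[p^∞]) = ord(δ̃)` with Cor. 1.6 (`ord(δ̃) < ∞` at a good
ordinary `p`, via the main conjecture localised at `XΛ`: Kato 2004 Thm. 17.4 + Burungale–Castella–
Skinner 2025 Thm. 1.1.2; provenance audit in the docstring of `Kim2022_kuriharaNumber_certificate`);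
the Manin hypothesis is automatic at a good `p ≥ 5` with `E[p]` irreducible (Mazur 1978; Abbes–Ullmo);
the passage from Kim's Néron-normalised `δ̃_n ∈ ℤ_p/I_n` to the tree's `Ω⁺_f`-normalised numbers mod
`p^k` costs a factor `u ∈ ℚˣ` (Edixhoven; `ModularParametrizationData.realPeriodRat_dvd`) absorbed by
enlarging `k` (Kim Lemma 3.14: `ord(p^t·δ̃) = ord(δ̃)`, and `∂^{(ord)}(δ̃) < ∞`). Size XL (Mazur–Rubin,
Büyükboduk rigidity, Kato's reciprocity law in derived form = Kim Thm. 3.13, IMC).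
[cite: Kim2022StructureSelmer, Thm. 1.9 (1), Cor. 1.6, Lemma 3.14, Thm. 3.13]
[cite: BurungaleCastellaSkinner2025, Thm. 1.1.2] [cite: Kato2004Asterisque, Thm. 17.4] -/
theorem stub_kim_order_le_corank :
    ∀ (W : WeierstrassCurve ℚ) [W.IsElliptic] [W.IsGloballyMinimal] (p : ℕ) [Fact p.Prime],
      5 ≤ p → W.HasGoodReductionAtPrime p → ¬ (p : ℤ) ∣ W.frobeniusTrace p →
      W.HasSurjectiveModNGaloisRep p →
      ∃ (_ : NeZero (W.conductorNorm ℤ)) (f : CuspForm (Gamma0 (W.conductorNorm ℤ)) 2),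
        IsNewformOf W f ∧
        ∃ (k n : ℕ) (_ : NeZero n), 1 ≤ k ∧ Kato.IsKolyvaginProduct W p k n ∧
          n.primeFactors.card ≤ W.selmerCorank p ∧
          ∃ ψ : (ℓ : ℕ) → (ZMod ℓ)ˣ →* Multiplicative (ZMod (p ^ k)),
            (∀ ℓ ∈ n.primeFactors, Function.Surjective (ψ ℓ)) ∧
            kuriharaNumber f (p ^ k) n ψ ≠ 0 := by
  -- CLOSED MODULO FACTS (wave 1, p147437): `Theorems.stub_kim_order_le_corank_of_facts :
  --   exists_isNewformOf → Kim2022_exists_kuriharaNumber_ne_zero_of_selmerCorank (F1, p147314) →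
  --   realPeriodRat_eq_unit_mul_plusPeriod (F2, p147303) → <this statement>`; the three named facts
  -- are unproved Literature leaves (modularity; Kim 2022 Thm 1.9(1)+Cor 1.6; period unit), so the
  -- stub itself stays open here.
  sorry

/-! ### Stub V0 — the bottom Kurihara number is `L(E,1)/Ω⁺` (known) -/

/-- **Stub V0 (`stub_delta_one`) — `r_an ≥ 1 ⇒ δ_1 = 0`.** For the newform `f` of `W` at level `N_E`
and every modulus `p^k` and choice of logarithms, `kuriharaNumber f (p^k) 1 ψ = \overline{[0]⁺_f}`
(`kuriharaNumber_one`) and `[0]⁺_f = L(f,1)/Ω⁺_f` (`ratCast_ratPlusSymbol`, conventions of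
`PAdicLFunction`/`ModularSymbols`: `[0]⁺ = re {∞,0}/Ω⁺_f = L(f,1)/Ω⁺_f`), while
`L(f,1) = L(E,1) = entireLFunction W 1 = 0` as soon as `ord_{s=1} ≥ 1` (`IsNewformOf.entireLFunction_eq`
/ `analyticRank_eq_order`, Hecke's continuation; `analyticRank` is the order at `1` of the entire
continuation). Known; size M (fact-relative today: the `s = 1` comparison `L(f,1) = L_entire(W,1)` and
`ratCast_ratPlusSymbol` are named facts of the tree). [cite: Kurihara2014, §1.1 (δ̃_1 = L(E,1)/Ω⁺)]
[cite: Kim2022StructureSelmer, §1.4.3] -/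
theorem stub_delta_one :
    ∀ (W : WeierstrassCurve ℚ) [W.IsElliptic] [W.IsGloballyMinimal] (p : ℕ) [Fact p.Prime]
      (_ : NeZero (W.conductorNorm ℤ)) (f : CuspForm (Gamma0 (W.conductorNorm ℤ)) 2),
      IsNewformOf W f → 1 ≤ W.analyticRank →
      ∀ (k : ℕ) (ψ : (ℓ : ℕ) → (ZMod ℓ)ˣ →* Multiplicative (ZMod (p ^ k))),
        kuriharaNumber f (p ^ k) 1 ψ = 0 :=
  -- LANDED (wave 1, p146416): `Theorems/SelmerRankSelmerRankLBStubDeltaOne.lean`, unconditional.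
  Theorems.stub_delta_one

/-! ### Stub V1 — the Mazur–Tate functional equation kills the wrong parity (known in print) -/

/-- **Stub V1 (`stub_delta_parity`) — `(−1)^{ν(n)} ≠ w(E) ⇒ δ_n^{(k)} = 0`.** For `W`, `p ≥ 5` good
ordinary with surjective `ρ̄`, the newform `f` of `W`, a level `k ≥ 1`, `n ∈ 𝒩_k` and surjective
logarithms: if `ν(n) + r_an` is ODD then `kuriharaNumber f (p^k) n ψ = 0`. In print: the functional
equation of the Mazur–Tate element `θ_{ℚ(μ_n)}` (Mazur–Tate 1987, (1.6)) gives
`w(E)·(−1)^{ν(n)}·δ̃_n = δ̃_n` in `ℤ_p/I_n ℤ_p` (Kurihara 2012 Lemma; Kim 2022 (3.x) and Prop. 3.16: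
"If `(−1)^{ν(n)} ≠ w(E)` then `δ̃_n = 0`"), and `w(E) = (−1)^{r_an}` (sign of the functional equation
= parity of the order at the centre; tree fact `WeierstrassCurve.even_analyticRank_iff`); `p` is odd so
`2δ̃ = 0 ⇒ δ̃ = 0`; `n ∈ 𝒩_k` gives `I_n ⊆ p^k ℤ_p`, so vanishing mod `I_n` implies vanishing mod `p^k`,
and the `Ω⁺_f`-normalisation differs from Kim's by a `p`-integral-compatible rational factor
(`IsNewformOf.norm_ratPlusSymbol_le_one`). Known; size L (Mazur–Tate functional equation for modular
symbols `[a/n]⁺ ↦ [−a N⁻¹/n]⁺`-type involution + the Taylor-coefficient bookkeeping of Kim §3.5).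
[cite: Kim2022StructureSelmer, Prop. 3.16 and §3.5] [cite: MazurTate1987, §1] -/
theorem stub_delta_parity :
    ∀ (W : WeierstrassCurve ℚ) [W.IsElliptic] [W.IsGloballyMinimal] (p : ℕ) [Fact p.Prime],
      5 ≤ p → W.HasGoodReductionAtPrime p → ¬ (p : ℤ) ∣ W.frobeniusTrace p →
      W.HasSurjectiveModNGaloisRep p →
      ∀ (_ : NeZero (W.conductorNorm ℤ)) (f : CuspForm (Gamma0 (W.conductorNorm ℤ)) 2),
        IsNewformOf W f →
        ∀ (k n : ℕ) [NeZero n], 1 ≤ k → Kato.IsKolyvaginProduct W p k n →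
          ¬ Even (n.primeFactors.card + W.analyticRank) →
          ∀ ψ : (ℓ : ℕ) → (ZMod ℓ)ˣ →* Multiplicative (ZMod (p ^ k)),
            (∀ ℓ ∈ n.primeFactors, Function.Surjective (ψ ℓ)) →
            kuriharaNumber f (p ^ k) n ψ = 0 :=
  -- LANDED (wave 1, p147595 + p147917 + p148163): `Theorems/SelmerRankSelmerRankLBStubDeltaParity.lean`
  -- (+ `…Lemmas`, `…NormRelation`), unconditional: Mazur–Tate functional equation + norm relation.
  Theorems.stub_delta_parity

/-! ### Stub V2a — the odd layer `ν(n) = 1` is the corank-1 `p`-converse (known in print, XL) -/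

/-- **Stub V2a (`stub_delta_prime_of_odd_rank`) — for `r_an` odd and `≥ 3`, every `δ̃_ℓ` vanishes.**
For `W`, `p ≥ 5` good ordinary with surjective `ρ̄`, the newform `f` of `W`, `k ≥ 1`, a Kolyvagin
PRIME `n = ℓ ∈ 𝒫_k` (`n ∈ 𝒩_k` with exactly one prime factor), `ord_{s=1} L(E,s)` odd and `≥ 3`, and
a surjective logarithm: `kuriharaNumber f (p^k) ℓ ψ = 0`. In print, but ONLY through Selmer groups:
if `δ̃_ℓ ≠ 0` then `cork_p Sel_{p^∞}(E/ℚ) = ord(δ̃) ≤ 1` (Kim 2022 Thm. 1.9 (1)); `L(E,1) = 0` gives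
`cork ≥ 1` (Kim Cor. 1.12, the rank-0 `p`-converse; or Burungale–Castella–Skinner 2025 Thm. 1.1.2
(L(E,1)=0 ⇒ corank ≥ 1)); so `cork = 1`, and the corank-1 `p`-converse (Burungale–Castella–Grossi–
Skinner 2026 Cor. 1 = arXiv:2312.09301; Yan–Zhu 2026 Cor. 1.4 = arXiv:2412.20078; Burungale–Skinner–
Tian–Wan 2024 Thm. 1.10 with (ram)) gives `ord_{s=1} L(E,s) = 1`, contradicting `r_an ≥ 3`; the period
/ modulus bookkeeping is as in stubs K and V1. Size XL (the whole converse machinery); recorded as a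
separate stub so that the open stub V2b starts at the first GENUINELY open instance. A direct,
Selmer-free proof of V2a — e.g. by the level-raising transport of the card, §Transfer: `ℓ ∈ 𝒫_k` is a
level-raising prime, `δ̃_ℓ(f) ≡ δ̃_ℓ(g_ℓ)` for the newform `g_ℓ ≡ f (mod p^k)` of level `N_E ℓ`, tame
exceptional zero at `ℓ`, Jochnowitz congruence + Gross–Zagier (`P_K` torsion) — is the line's proving
ground. [cite: Kim2022StructureSelmer, Thm. 1.9 (1), Cor. 1.12] [cite: BurungaleEtAl2026, Cor. 1]
[cite: arXiv:2412.20078, Cor. 1.4] -/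
theorem stub_delta_prime_of_odd_rank :
    ∀ (W : WeierstrassCurve ℚ) [W.IsElliptic] [W.IsGloballyMinimal] (p : ℕ) [Fact p.Prime],
      5 ≤ p → W.HasGoodReductionAtPrime p → ¬ (p : ℤ) ∣ W.frobeniusTrace p →
      W.HasSurjectiveModNGaloisRep p →
      ∀ (_ : NeZero (W.conductorNorm ℤ)) (f : CuspForm (Gamma0 (W.conductorNorm ℤ)) 2),
        IsNewformOf W f →
        ∀ (k n : ℕ) [NeZero n], 1 ≤ k → Kato.IsKolyvaginProduct W p k n → n.primeFactors.card = 1 →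
          Odd W.analyticRank → 3 ≤ W.analyticRank →
          ∀ ψ : (ℓ : ℕ) → (ZMod ℓ)ˣ →* Multiplicative (ZMod (p ^ k)),
            (∀ ℓ ∈ n.primeFactors, Function.Surjective (ψ ℓ)) →
            kuriharaNumber f (p ^ k) n ψ = 0 := by
  -- CLOSED MODULO FACTS (wave 1, p147133): `Theorems.stub_delta_prime_of_odd_rank_of_facts :
  --   Kim2022_selmerCorank_le_of_kuriharaNumber_ne_zero (F3) → yanZhu_analyticRank_eq_one_of_selmerCorank_eq_one (F4)
  --   → (∀ W p, selmerCorank_mod_two_eq W p) → <F2 statement> → <this statement>` (facts p147132);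
  -- unproved Literature leaves, so the stub itself stays open here.
  sorry

/-! ### Stub V2b — the EVEN GAP: Kurihara numbers of the right parity vanish strictly between `2` and the analytic rank (OPEN CORE) -/

/-- **Stub V2b (`stub_delta_evenGap`) — the open core of the line.** For `W`, `p ≥ 5` good ordinary
with surjective `ρ̄`, the newform `f` of `W`, `k ≥ 1`, `n ∈ 𝒩_k` with `2 ≤ ν(n) < r_an = ord_{s=1} L(E,s)`
and `ν(n) ≡ r_an (mod 2)`, and surjective logarithms: `kuriharaNumber f (p^k) n ψ = 0`.
Equivalently (given stubs K, V0, V1, V2a and Kim's theorem): the crux from `r_an = 4` on. FIRST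
INSTANCE `(r_an, ν(n)) = (4, 2)`: for `ord_{s=1} L(E,s) = 4`, every
`δ̃_{ℓℓ'} = Σ_{a mod ℓℓ'} [a/ℓℓ']⁺ log_{η_ℓ}(a) log_{η_ℓ'}(a)` vanishes mod `p^k` — the rank-2
`p`-converse with all algebra (Selmer groups, Iwasawa modules, heights, `Ш`) discharged by stub K.
Predicted by BSD ∘ Kim, and by the analytic-rank form of the Mazur–Tate weak vanishing conjecture
`θ_{ℚ(μ_n)} ∈ I^{r_an}` (Mazur–Tate 1987 Conj. 1: the top mixed coefficient of an element of
`I^{ν(n)+1} + p^k ℤ_p[G_n]` vanishes, Kim §3.5). WHY IT MIGHT FAIL: it cannot be false unless BSD-rank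
is (Kim Cor. 1.14: `δ̃_n ≠ 0 ⇒ rank E(ℚ) ≤ ν(n)`), so every computable instance on a curve whose
`ν(n) + 1` independent points are known is automatically `0`; the risk is that a direct proof needs an
arithmetic avatar of `L''(E,1) = 0`, which no one has over `ℚ` (Yun–Zhang 2017 exists only over
function fields). The level-raising transport of the card (§Transfer) moves `(4,2)` to: "the central
values `L(g,1)/Ω_g` of all double Kolyvagin level-raisings `g ≡ f (mod p^k)` of level `N_E ℓℓ'`
(global sign `+1` again) are `≡ 0 (mod 𝔭^k)`" — central VALUES of congruent forms, the objects of
Vatsal / Bertolini–Darmon / W. Zhang. [cite: Kim2022StructureSelmer, Thm. 1.9, Cor. 1.14, §3.5]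
[cite: MazurTate1987, Conj. 1] [cite: YunZhang2017, Introduction] -/
theorem stub_delta_evenGap :
    ∀ (W : WeierstrassCurve ℚ) [W.IsElliptic] [W.IsGloballyMinimal] (p : ℕ) [Fact p.Prime],
      5 ≤ p → W.HasGoodReductionAtPrime p → ¬ (p : ℤ) ∣ W.frobeniusTrace p →
      W.HasSurjectiveModNGaloisRep p →
      ∀ (_ : NeZero (W.conductorNorm ℤ)) (f : CuspForm (Gamma0 (W.conductorNorm ℤ)) 2),
        IsNewformOf W f →
        ∀ (k n : ℕ) [NeZero n], 1 ≤ k → Kato.IsKolyvaginProduct W p k n → 2 ≤ n.primeFactors.card →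
          Even (n.primeFactors.card + W.analyticRank) →
          n.primeFactors.card < W.analyticRank →
          ∀ ψ : (ℓ : ℕ) → (ZMod ℓ)ˣ →* Multiplicative (ZMod (p ^ k)),
            (∀ ℓ ∈ n.primeFactors, Function.Surjective (ψ ℓ)) →
            kuriharaNumber f (p ^ k) n ψ = 0 := by
  sorry

/-! ### The stub statements as named propositions -/

namespace Statement

/-- Statement of stub K. [folklore] -/
abbrev stub_kim_order_le_corank : Prop := type_of% @KuriharaOrder.stub_kim_order_le_corank
/-- Statement of stub V2a. [folklore] -/
abbrev stub_delta_prime_of_odd_rank : Prop := type_of% @KuriharaOrder.stub_delta_prime_of_odd_rank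
/-- Statement of stub V2b. [folklore] -/
abbrev stub_delta_evenGap : Prop := type_of% @KuriharaOrder.stub_delta_evenGap

end Statement

/-! ### Composition: the five stubs imply the crux BY NAME (sorry-free) -/

/-- A non-zero natural number other than `1` has a prime factor. [folklore] -/
theorem one_le_card_primeFactors {n : ℕ} (h0 : n ≠ 0) (h1 : n ≠ 1) : 1 ≤ n.primeFactors.card := by
  rw [Nat.one_le_iff_ne_zero, Ne, Finset.card_eq_zero, Nat.primeFactors_eq_empty]
  omega

/-- **(KV) assembled**: under stubs V2a, V2b (and the landed theorems V0 `stub_delta_one`, V1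
`stub_delta_parity`), every Kurihara number of level `k ≥ 1` at a Kolyvagin product `n ∈ 𝒩_k` with
`ν(n) < r_an` vanishes (case split `n = 1` / parity / `ν(n) = 1` / `ν(n) ≥ 2`). [folklore] -/
theorem kuriharaNumber_eq_zero_of_lt_analyticRank
    (hV2a : Statement.stub_delta_prime_of_odd_rank) (hV2b : Statement.stub_delta_evenGap)
    (W : WeierstrassCurve ℚ) [W.IsElliptic] [W.IsGloballyMinimal] (p : ℕ) [Fact p.Prime]
    (h5 : 5 ≤ p) (hgood : W.HasGoodReductionAtPrime p) (hord : ¬ (p : ℤ) ∣ W.frobeniusTrace p)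
    (hsurj : W.HasSurjectiveModNGaloisRep p)
    (hN : NeZero (W.conductorNorm ℤ)) (f : CuspForm (Gamma0 (W.conductorNorm ℤ)) 2)
    (hf : IsNewformOf W f) (k n : ℕ) [hn0 : NeZero n] (hk : 1 ≤ k)
    (hn : Kato.IsKolyvaginProduct W p k n) (hν : n.primeFactors.card < W.analyticRank)
    (ψ : (ℓ : ℕ) → (ZMod ℓ)ˣ →* Multiplicative (ZMod (p ^ k)))
    (hψ : ∀ ℓ ∈ n.primeFactors, Function.Surjective (ψ ℓ)) :
    kuriharaNumber f (p ^ k) n ψ = 0 := by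
  rcases eq_or_ne n 1 with rfl | hn1
  · exact stub_delta_one W p hN f hf (by omega) k ψ
  · rcases Nat.even_or_odd (n.primeFactors.card + W.analyticRank) with he | ho
    · have h1 : 1 ≤ n.primeFactors.card := one_le_card_primeFactors hn0.out hn1
      rcases h1.eq_or_lt with h1' | h2
      · -- ν(n) = 1 and 1 + r_an even: r_an is odd and ≥ 3
        have hodd : Odd W.analyticRank := by
          rw [← h1'] at he
          exact (Nat.even_add_one (n := W.analyticRank)).mp (by simpa [add_comm] using he) |>
            Nat.not_even_iff_odd.mp
        have h3 : 3 ≤ W.analyticRank := by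
          obtain ⟨m, hm⟩ := hodd
          omega
        exact hV2a W p h5 hgood hord hsurj hN f hf k n hk hn h1'.symm hodd h3 ψ hψ
      · exact hV2b W p h5 hgood hord hsurj hN f hf k n hk hn h2 he hν ψ hψ
    · exact stub_delta_parity W p h5 hgood hord hsurj hN f hf k n hk hn (Nat.not_even_iff_odd.mpr ho) ψ
        hψ

/-- **The line concludes the crux by name**: `K → V2a → V2b → SelmerRank.SelmerRankLB` (V0, V1 landed)
(the shared item stmt-BirchSwinnertonDyer-0131; `TangentCone.SelmerRankLB` etc. are `rfl`-equal).
If `corank_p < r_an`, the witness `n` of stub K has `ν(n) ≤ corank_p < r_an`, so its Kurihara number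
vanishes by `(KV)` — contradiction with K. [folklore] -/
theorem SelmerRankLB_of (hK : Statement.stub_kim_order_le_corank)
    (hV2a : Statement.stub_delta_prime_of_odd_rank) (hV2b : Statement.stub_delta_evenGap) :
    SelmerRank.SelmerRankLB := by
  intro W _ _ p _ h5 hgood hord hsurj
  obtain ⟨hN, f, hf, k, n, hn0, hk, hkoly, hνle, ψ, hψ, hne⟩ := hK W p h5 hgood hord hsurj
  by_contra hlt
  push Not at hlt
  haveI := hn0
  exact hne (kuriharaNumber_eq_zero_of_lt_analyticRank hV2a hV2b W p h5 hgood hord hsurj hN f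
    hf k n hk hkoly (lt_of_le_of_lt hνle hlt) ψ hψ)

/-- Sorry-closed inhabitant of the crux along this line (the sorries are exactly the three open
stubs K, V2a, V2b; V0 and V1 are theorems).
[folklore] -/
theorem SelmerRankLB_proof : SelmerRank.SelmerRankLB :=
  SelmerRankLB_of stub_kim_order_le_corank stub_delta_prime_of_odd_rank stub_delta_evenGap

end Summit.BirchSwinnertonDyer.BirchSwinnertonDyer.Cruxes.SelmerRankLB.KuriharaOrder

end
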